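import Summits.QuantumFields.BalabanUV.Beta.FP.ValueFunctionThirdJetEnvelope

/-!
# `BalabanUV.Beta.FP.ValueFunctionThirdJetPolar` — road «FP» for binder row D1, row **H2V-4′-a (MODEL)**, sequel of `FP/ValueFunctionThirdJet(Envelope)`:
# **THE POLARISED THIRD JET** `D³V(c₀)[a,b,c] = −∂H[Hc]Hb ⬝ Ha − (ω̇a ⬝ ∂J[Hc]Hb + ω̇b ⬝ ∂J[Hc]Ha + ω̇c ⬝ ∂J[Hb]Ha)` with `ω̇ = −Δ` — H2V4-STATEMENT §2's
# `∂³S_j(𝟙)[a,b,c] = ∂³S_W(𝟙)[H_ja,H_jb,H_jc] − 3·Sym⟨Δ_j a, ∂²Q_j(𝟙)[H_jb,H_jc]⟩` WITH ALL THREE ARGUMENTS FREE (argument placements explicit; no symmetry of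
# `A‴` or `∂²Q` is assumed or used — only that of the Hessian `H_c`)

HONEST DEPENDENCY (cell records, verbatim): «continuum YM on T⁴ ⇐ BetaPertH ∧ nine spine estimates (0/9 proved); BetaPertH ⇐ (D1) ∧ (D4) ∧
CAP+tail; G-an2-4 gates asym, D1 and NE2/3/4.»  HONEST FRAMING (cell contract, verbatim): «discharging `BetaPertH` makes Bałaban's UV stability
UNCONDITIONAL — a real constructive-QFT result; it is NOT the continuum limit and NOT the Clay problem.»  THIS MODULE is [folklore] finite-dimensional
calculus over `FP/ValueFunctionThirdJet` (product rules, `jac_mulVec_dU_line`, `stationarity_deriv_line`, `dU_dω_eq_of_identities`) and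
`FP/ValueFunctionThirdJetEnvelope` (`fderiv_fderiv_value`) BY NAME; the only new ingredient is that the once-differentiated identities hold AT EVERY
BASE POINT near `c₀` (neighbourhoods of neighbourhoods), so that they can be differentiated along a SECOND direction.  NO estimate, NO lattice object,
nothing of Bałaban's manuscripts, no definition, no `def … : Prop`, nothing cited, 0 sorry.  NOT D1, NOT BetaPertH, NOT continuum, NOT Clay.

ABSOLUTE RULE (cell charter, verbatim): «No internally-minted statement may enter as a cited fact. Every hypothesis is either kernel-proved in this
package or a verbatim quotation of a PUBLISHED theorem with page reference. The manuscript(s) under audit are NOT citable for their own disputed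
steps — they are the thing under adjudication; programme-internal (2001/route/tribunal) claims are never citable.»

WHAT IS PROVED (letters of `FP/ValueFunctionThirdJet`; all [folklore]): `hasDerivAt_jet_comp_curve₂` (mixed second jet of a composite), `jac_mulVec_dU_nhds` ∕ `stationarity_deriv_nhds` (the two once-differentiated
identities at every base point near `c₀`), `hasDerivAt_dU_line₂` (`s ↦ dU (c₀ + s•c) b` has derivative `d2U c b` at 0), `jac_mulVec_d2U_polar`
(`∂J[Hc]Hb + J·U″[c,b] = 0`), **`d2ω_dotProduct_polar`** (`(d2ω c b) ⬝ a = −(Ha ⬝ ∂H[Hc]Hb) − ω̇a ⬝ ∂J[Hc]Hb − ω̇b ⬝ ∂J[Hc]Ha − ω̇c ⬝ ∂J[Hb]Ha` with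
`Hx := dU c₀ x`, `ω̇x := dω c₀ x`, `∂H[v]w := Matrix.of (dH v) *ᵥ w`, `∂J[v]w := Matrix.of (dJf (U c₀) v) *ᵥ w`; tadpole-free base point, `Hf (U c₀)`
symmetric, NO non-degeneracy), and **`hasDerivAt_thirdJet_value_polar`** (`s ↦ D²V(c₀ + s•c)[b][a]` has derivative at 0 the same expression with
`H = minOp H_c J_c`, `−ω̇ = Δ = effForm H_c J_c` — the row's display with all three arguments free).  The diagonal `a = b = c` is
`ValueFunctionThirdJetEnvelope.hasDerivAt_thirdJet_value_line`.
NOT HERE (honest): symmetry of `D³V` ∕ of `∂²Q` (not needed for the identity as stated), existence of the branch (IFT), the road instance `A = S_W`,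
`Q = Q_j`, any estimate; 0∕4 row-D1 binders touched.
Provenance: NE9 formalisation swarm leaf seat `b2b-balaban-t4-ne9-formalise-leaf-04` gen 38 on cross-cell kernel duty (road «FP» row H2V-4′-a pt 2), 2026-08-21.
-/

noncomputable section

namespace Summit.QuantumFields.BalabanUV.Beta.FP.ValueFunctionThirdJetPolar

open Matrix Filter Topology
open Literature.MathematicalPhysics.QuantumFieldTheory.Balaban1983to89.Beta.Composition (kkt)
open Literature.MathematicalPhysics.QuantumFieldTheory.Balaban1983to89.Beta.CompositionSingular (minOp effForm)
open Summit.QuantumFields.BalabanUV.Beta.ConstrainedCriticalMap (mulVecCLM mulVecCLM_apply dotCLM dotCLM_apply)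
open Summit.QuantumFields.BalabanUV.Beta.FP.OneShotKKTTorus (hasDerivAt_comp_line)
open Summit.QuantumFields.BalabanUV.Beta.FP.RootFixingGaugeForm (hasDerivAt_ax_line)
open Summit.QuantumFields.BalabanUV.Beta.FP.ValueFunctionThirdJet (hasDerivAt_of_mulVec hasDerivAt_of_transpose_mulVec hasDerivAt_dotProduct
  transpose_mulVec_dotProduct jac_mulVec_dU_line stationarity_deriv_line dU_dω_eq_of_identities)
open Summit.QuantumFields.BalabanUV.Beta.FP.ValueFunctionThirdJetEnvelope (fderiv_fderiv_value)

section Polar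

variable {κ μ : Type*} [Fintype κ] [Fintype μ] [DecidableEq κ] [DecidableEq μ]

omit [Fintype κ] [Fintype μ] [DecidableEq κ] [DecidableEq μ] in
/-- [folklore] MIXED SECOND JET OF A COMPOSITE: if `γ` has derivative `γ'` at `t`, `δ` has derivative `w` at `t` and the field `dHf` has Fréchet
derivative `d2Hf` at `γ t`, then `u ↦ dHf (γ u) (δ u)` has derivative `d2Hf γ' (δ t) + dHf (γ t) w` at `t` (the `γ₁ = δ` case is
`OneShotKKTTorus.hasDerivAt_jet₁_comp_curve`). -/
theorem hasDerivAt_jet_comp_curve₂ {E F : Type*} [NormedAddCommGroup E] [NormedSpace ℝ E] [NormedAddCommGroup F] [NormedSpace ℝ F]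
    {γ δ : ℝ → E} {γ' w : E} {t : ℝ} {dHf : E → (E →L[ℝ] F)} {d2Hf : E →L[ℝ] E →L[ℝ] F}
    (hγ : HasDerivAt γ γ' t) (hδ : HasDerivAt δ w t) (hdH : HasFDerivAt dHf d2Hf (γ t)) :
    HasDerivAt (fun u => dHf (γ u) (δ u)) (d2Hf γ' (δ t) + dHf (γ t) w) t :=
  (hdH.comp_hasDerivAt t hγ).clm_apply hδ

omit [DecidableEq κ] [DecidableEq μ] in
/-- [folklore] **`Q′H = 1` AT EVERY BASE POINT NEAR `c₀`**: `J(U c) · dU c b = b` for `c` near `c₀`. -/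
theorem jac_mulVec_dU_nhds {Q : (κ → ℝ) → (μ → ℝ)} {Jf : (κ → ℝ) → μ → κ → ℝ} {U : (μ → ℝ) → (κ → ℝ)}
    {dU : (μ → ℝ) → ((μ → ℝ) →L[ℝ] (κ → ℝ))} {c₀ : μ → ℝ}
    (hQ : ∀ᶠ x in 𝓝 (U c₀), HasFDerivAt Q (mulVecCLM (Matrix.of (Jf x))) x) (hU : ∀ᶠ c in 𝓝 c₀, HasFDerivAt U (dU c) c)
    (hid : ∀ᶠ c in 𝓝 c₀, Q (U c) = c) (b : μ → ℝ) :
    ∀ᶠ c in 𝓝 c₀, Matrix.of (Jf (U c)) *ᵥ dU c b = b := by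
  have hUc : ContinuousAt U c₀ := hU.self_of_nhds.continuousAt
  filter_upwards [hUc.eventually hQ.eventually_nhds, hU.eventually_nhds, hid.eventually_nhds] with c hQc hUc' hidc
  have h := (jac_mulVec_dU_line hQc hUc' hidc b).self_of_nhds
  rwa [zero_smul, add_zero] at h

omit [DecidableEq κ] [DecidableEq μ] in
/-- [folklore] **THE STATIONARITY DIFFERENTIATED ONCE, AT EVERY BASE POINT NEAR `c₀`**:
`H(U c)·dU c b + (∂J[dU c b])ᵀ·ω c + J(U c)ᵀ·dω c b = 0` for `c` near `c₀`. -/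
theorem stationarity_deriv_nhds {f : (κ → ℝ) → (κ → ℝ)} {Hf : (κ → ℝ) → κ → κ → ℝ} {Jf : (κ → ℝ) → μ → κ → ℝ}
    {dJf : (κ → ℝ) → ((κ → ℝ) →L[ℝ] (μ → κ → ℝ))} {U : (μ → ℝ) → (κ → ℝ)} {dU : (μ → ℝ) → ((μ → ℝ) →L[ℝ] (κ → ℝ))}
    {ω : (μ → ℝ) → (μ → ℝ)} {dω : (μ → ℝ) → ((μ → ℝ) →L[ℝ] (μ → ℝ))} {c₀ : μ → ℝ}
    (hf : ∀ᶠ x in 𝓝 (U c₀), HasFDerivAt f (mulVecCLM (Matrix.of (Hf x))) x)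
    (hJ : ∀ᶠ x in 𝓝 (U c₀), HasFDerivAt Jf (dJf x) x)
    (hU : ∀ᶠ c in 𝓝 c₀, HasFDerivAt U (dU c) c) (hω : ∀ᶠ c in 𝓝 c₀, HasFDerivAt ω (dω c) c)
    (hid : ∀ᶠ c in 𝓝 c₀, f (U c) + (Matrix.of (Jf (U c)))ᵀ *ᵥ ω c = 0) (b : μ → ℝ) :
    ∀ᶠ c in 𝓝 c₀, Matrix.of (Hf (U c)) *ᵥ dU c b + ((Matrix.of (dJf (U c) (dU c b)))ᵀ *ᵥ ω c
      + (Matrix.of (Jf (U c)))ᵀ *ᵥ dω c b) = 0 := by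
  have hUc : ContinuousAt U c₀ := hU.self_of_nhds.continuousAt
  filter_upwards [hUc.eventually hf.eventually_nhds, hUc.eventually hJ.eventually_nhds, hU.eventually_nhds, hω.eventually_nhds,
    hid.eventually_nhds] with c hfc hJc hUc' hωc hidc
  have h := (stationarity_deriv_line hfc hJc hUc' hωc hidc b).self_of_nhds
  rwa [zero_smul, add_zero] at h

omit [Fintype κ] [Fintype μ] [DecidableEq κ] [DecidableEq μ] in
/-- [folklore] Along the line `c₀ + s•c` the first jet in a FIXED second direction `b`, `s ↦ dU (c₀ + s•c) b`, has derivative `d2U c b` at `0`. -/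
theorem hasDerivAt_dU_line₂ {E F : Type*} [NormedAddCommGroup E] [NormedSpace ℝ E] [NormedAddCommGroup F] [NormedSpace ℝ F]
    {dU : F → (F →L[ℝ] E)} {d2U : F →L[ℝ] F →L[ℝ] E} {c₀ : F} (hdU : HasFDerivAt dU d2U c₀) (c b : F) :
    HasDerivAt (fun s : ℝ => dU (c₀ + s • c) b) (d2U c b) 0 := by
  have h := (hasDerivAt_comp_line hdU c).clm_apply (hasDerivAt_const (0 : ℝ) b)
  refine h.congr_deriv ?_
  rw [map_zero, add_zero]

omit [DecidableEq κ] [DecidableEq μ] in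
/-- [folklore] **`∂J[Hc]Hb + J·U″[c,b] = 0`** — the constraint differentiated in direction `b`, then in direction `c`, at `c₀`. -/
theorem jac_mulVec_d2U_polar {Q : (κ → ℝ) → (μ → ℝ)} {Jf : (κ → ℝ) → μ → κ → ℝ} {dJf : (κ → ℝ) → ((κ → ℝ) →L[ℝ] (μ → κ → ℝ))}
    {U : (μ → ℝ) → (κ → ℝ)} {dU : (μ → ℝ) → ((μ → ℝ) →L[ℝ] (κ → ℝ))} {d2U : (μ → ℝ) →L[ℝ] (μ → ℝ) →L[ℝ] (κ → ℝ)} {c₀ : μ → ℝ}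
    (hQ : ∀ᶠ x in 𝓝 (U c₀), HasFDerivAt Q (mulVecCLM (Matrix.of (Jf x))) x) (hJ : HasFDerivAt Jf (dJf (U c₀)) (U c₀))
    (hU : ∀ᶠ c in 𝓝 c₀, HasFDerivAt U (dU c) c) (hdU : HasFDerivAt dU d2U c₀)
    (hid : ∀ᶠ c in 𝓝 c₀, Q (U c) = c) (b c : μ → ℝ) :
    Matrix.of (dJf (U c₀) (dU c₀ c)) *ᵥ dU c₀ b + Matrix.of (Jf (U c₀)) *ᵥ d2U c b = 0 := by
  have e0 : c₀ + (0 : ℝ) • c = c₀ := by rw [zero_smul, add_zero]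
  have hline : ∀ s : ℝ, HasDerivAt (fun s : ℝ => c₀ + s • c) c s := fun s => by
    have h := ((hasDerivAt_id s).smul_const c).const_add c₀
    rwa [one_smul] at h
  have hcont : Tendsto (fun s : ℝ => c₀ + s • c) (𝓝 0) (𝓝 c₀) := by
    have h := (hline 0).continuousAt.tendsto
    rwa [zero_smul, add_zero] at h
  have hu0 : HasDerivAt (fun s : ℝ => U (c₀ + s • c)) (dU (c₀ + (0 : ℝ) • c) c) 0 := (hasDerivAt_ax_line hU c).self_of_nhds
  have hJ' : HasFDerivAt Jf (dJf (U c₀)) ((fun s : ℝ => U (c₀ + s • c)) 0) := by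
    show HasFDerivAt Jf (dJf (U c₀)) (U (c₀ + (0 : ℝ) • c)); rw [e0]; exact hJ
  have hJc : HasDerivAt (fun s : ℝ => Jf (U (c₀ + s • c))) (dJf (U c₀) (dU (c₀ + (0 : ℝ) • c) c)) 0 := hJ'.comp_hasDerivAt (0 : ℝ) hu0
  rw [e0] at hJc
  have hE : ∀ᶠ s in 𝓝 (0 : ℝ), Matrix.of (Jf (U (c₀ + s • c))) *ᵥ dU (c₀ + s • c) b = b := hcont.eventually (jac_mulVec_dU_nhds hQ hU hid b)
  have h1 := hasDerivAt_of_mulVec hJc (hasDerivAt_dU_line₂ hdU c b)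
  simp only [e0] at h1
  have h2 : HasDerivAt (fun s : ℝ => Matrix.of (Jf (U (c₀ + s • c))) *ᵥ dU (c₀ + s • c) b) (0 : μ → ℝ) 0 :=
    (hasDerivAt_const (0 : ℝ) b).congr_of_eventuallyEq hE
  exact h1.unique h2

omit [DecidableEq κ] [DecidableEq μ] in
/-- [folklore] **THE POLARISED THIRD-ORDER IDENTITY (raw form, no non-degeneracy needed).**  With `Hx := dU c₀ x`, `ω̇x := dω c₀ x`,
`∂H[v]w := Matrix.of (dH v) *ᵥ w`, `∂J[v]w := Matrix.of (dJf (U c₀) v) *ᵥ w`, at a TADPOLE-FREE base point (`ω c₀ = 0`) with `Hf (U c₀)` symmetric: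
`(d2ω c b) ⬝ a = −(Ha ⬝ ∂H[Hc]Hb) − ω̇a ⬝ ∂J[Hc]Hb − ω̇b ⬝ ∂J[Hc]Ha − ω̇c ⬝ ∂J[Hb]Ha` (argument placements as they come; NO symmetry of `∂H`,
`∂J` assumed). -/
theorem d2ω_dotProduct_polar {f : (κ → ℝ) → (κ → ℝ)} {Hf : (κ → ℝ) → κ → κ → ℝ} {dH : (κ → ℝ) →L[ℝ] (κ → κ → ℝ)}
    {Q : (κ → ℝ) → (μ → ℝ)} {Jf : (κ → ℝ) → μ → κ → ℝ} {dJf : (κ → ℝ) → ((κ → ℝ) →L[ℝ] (μ → κ → ℝ))}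
    {d2Jf : (κ → ℝ) →L[ℝ] (κ → ℝ) →L[ℝ] (μ → κ → ℝ)}
    {U : (μ → ℝ) → (κ → ℝ)} {dU : (μ → ℝ) → ((μ → ℝ) →L[ℝ] (κ → ℝ))} {d2U : (μ → ℝ) →L[ℝ] (μ → ℝ) →L[ℝ] (κ → ℝ)}
    {ω : (μ → ℝ) → (μ → ℝ)} {dω : (μ → ℝ) → ((μ → ℝ) →L[ℝ] (μ → ℝ))} {d2ω : (μ → ℝ) →L[ℝ] (μ → ℝ) →L[ℝ] (μ → ℝ)} {c₀ : μ → ℝ}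
    (hf : ∀ᶠ x in 𝓝 (U c₀), HasFDerivAt f (mulVecCLM (Matrix.of (Hf x))) x) (hH : HasFDerivAt Hf dH (U c₀))
    (hsym : (Matrix.of (Hf (U c₀)))ᵀ = Matrix.of (Hf (U c₀)))
    (hQ : ∀ᶠ x in 𝓝 (U c₀), HasFDerivAt Q (mulVecCLM (Matrix.of (Jf x))) x) (hJ : ∀ᶠ x in 𝓝 (U c₀), HasFDerivAt Jf (dJf x) x)
    (hdJ : HasFDerivAt dJf d2Jf (U c₀))
    (hU : ∀ᶠ c in 𝓝 c₀, HasFDerivAt U (dU c) c) (hdU : HasFDerivAt dU d2U c₀)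
    (hω : ∀ᶠ c in 𝓝 c₀, HasFDerivAt ω (dω c) c) (hdω : HasFDerivAt dω d2ω c₀)
    (hid : ∀ᶠ c in 𝓝 c₀, f (U c) + (Matrix.of (Jf (U c)))ᵀ *ᵥ ω c = 0 ∧ Q (U c) = c) (hω0 : ω c₀ = 0) (a b c : μ → ℝ) :
    d2ω c b ⬝ᵥ a = -(dU c₀ a ⬝ᵥ (Matrix.of (dH (dU c₀ c)) *ᵥ dU c₀ b))
      - dω c₀ a ⬝ᵥ (Matrix.of (dJf (U c₀) (dU c₀ c)) *ᵥ dU c₀ b)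
      - dω c₀ b ⬝ᵥ (Matrix.of (dJf (U c₀) (dU c₀ c)) *ᵥ dU c₀ a)
      - dω c₀ c ⬝ᵥ (Matrix.of (dJf (U c₀) (dU c₀ b)) *ᵥ dU c₀ a) := by
  have e0 : c₀ + (0 : ℝ) • c = c₀ := by rw [zero_smul, add_zero]
  have hline : ∀ s : ℝ, HasDerivAt (fun s : ℝ => c₀ + s • c) c s := fun s => by
    have h := ((hasDerivAt_id s).smul_const c).const_add c₀
    rwa [one_smul] at h
  have hcont : Tendsto (fun s : ℝ => c₀ + s • c) (𝓝 0) (𝓝 c₀) := by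
    have h := (hline 0).continuousAt.tendsto
    rwa [zero_smul, add_zero] at h
  -- jets along the line in direction `c`, first jets taken in the fixed direction `b`
  have hu0 : HasDerivAt (fun s : ℝ => U (c₀ + s • c)) (dU (c₀ + (0 : ℝ) • c) c) 0 := (hasDerivAt_ax_line hU c).self_of_nhds
  have hub : HasDerivAt (fun s : ℝ => dU (c₀ + s • c) b) (d2U c b) 0 := hasDerivAt_dU_line₂ hdU c b
  have hw0 : HasDerivAt (fun s : ℝ => ω (c₀ + s • c)) (dω (c₀ + (0 : ℝ) • c) c) 0 := (hasDerivAt_ax_line hω c).self_of_nhds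
  have hwb : HasDerivAt (fun s : ℝ => dω (c₀ + s • c) b) (d2ω c b) 0 := hasDerivAt_dU_line₂ hdω c b
  -- the matrix fields along the line, at 0
  have hH' : HasFDerivAt Hf dH ((fun s : ℝ => U (c₀ + s • c)) 0) := by
    show HasFDerivAt Hf dH (U (c₀ + (0 : ℝ) • c)); rw [e0]; exact hH
  have hHc : HasDerivAt (fun s : ℝ => Hf (U (c₀ + s • c))) (dH (dU (c₀ + (0 : ℝ) • c) c)) 0 := hH'.comp_hasDerivAt (0 : ℝ) hu0
  have hJ0 : HasFDerivAt Jf (dJf (U c₀)) ((fun s : ℝ => U (c₀ + s • c)) 0) := by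
    show HasFDerivAt Jf (dJf (U c₀)) (U (c₀ + (0 : ℝ) • c)); rw [e0]; exact hJ.self_of_nhds
  have hJc : HasDerivAt (fun s : ℝ => Jf (U (c₀ + s • c))) (dJf (U c₀) (dU (c₀ + (0 : ℝ) • c) c)) 0 :=
    hJ0.comp_hasDerivAt (0 : ℝ) hu0
  have hdJ' : HasFDerivAt dJf d2Jf ((fun s : ℝ => U (c₀ + s • c)) 0) := by
    show HasFDerivAt dJf d2Jf (U (c₀ + (0 : ℝ) • c)); rw [e0]; exact hdJ
  have hX := hasDerivAt_jet_comp_curve₂ (γ := fun s : ℝ => U (c₀ + s • c)) (δ := fun s : ℝ => dU (c₀ + s • c) b) hu0 hub hdJ'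
  -- the once-differentiated stationarity (direction `b`) holds along the line; differentiate it at 0
  have hT := (hasDerivAt_of_mulVec hHc hub).add ((hasDerivAt_of_transpose_mulVec hX hw0).add (hasDerivAt_of_transpose_mulVec hJc hwb))
  have hS1 : ∀ᶠ s in 𝓝 (0 : ℝ), Matrix.of (Hf (U (c₀ + s • c))) *ᵥ dU (c₀ + s • c) b
      + ((Matrix.of (dJf (U (c₀ + s • c)) (dU (c₀ + s • c) b)))ᵀ *ᵥ ω (c₀ + s • c)
        + (Matrix.of (Jf (U (c₀ + s • c))))ᵀ *ᵥ dω (c₀ + s • c) b) = 0 :=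
    hcont.eventually (stationarity_deriv_nhds hf hJ hU hω (hid.mono fun c h => h.1) b)
  have hT0 : HasDerivAt (fun s : ℝ => Matrix.of (Hf (U (c₀ + s • c))) *ᵥ dU (c₀ + s • c) b
      + ((Matrix.of (dJf (U (c₀ + s • c)) (dU (c₀ + s • c) b)))ᵀ *ᵥ ω (c₀ + s • c)
        + (Matrix.of (Jf (U (c₀ + s • c))))ᵀ *ᵥ dω (c₀ + s • c) b)) (0 : κ → ℝ) 0 :=
    (hasDerivAt_const (0 : ℝ) (0 : κ → ℝ)).congr_of_eventuallyEq hS1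
  have hS2 := hT.unique hT0
  simp only [e0, hω0, Matrix.mulVec_zero, zero_add] at hS2
  -- first- and second-order identities at the base point
  have p2a : Matrix.of (Jf (U c₀)) *ᵥ dU c₀ a = a := (jac_mulVec_dU_nhds hQ hU (hid.mono fun c h => h.2) a).self_of_nhds
  have p1a : Matrix.of (Hf (U c₀)) *ᵥ dU c₀ a + (Matrix.of (Jf (U c₀)))ᵀ *ᵥ dω c₀ a = 0 := by
    have h := (stationarity_deriv_nhds hf hJ hU hω (hid.mono fun c h => h.1) a).self_of_nhds
    rwa [hω0, Matrix.mulVec_zero, zero_add] at h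
  have pE2 := jac_mulVec_d2U_polar hQ hJ.self_of_nhds hU hdU (hid.mono fun c h => h.2) b c
  -- scalar bookkeeping: pair (S2) with `Ha := dU c₀ a` (the calculus hypotheses are no longer needed)
  clear hT hT0 hX hHc hJc hH' hJ0 hdJ' hu0 hub hw0 hwb hcont hline e0 hf hH hQ hJ hdJ hU hdU hω hdω hid
  set ua := dU c₀ a with hua
  set ub := dU c₀ b with hub_def
  set uc := dU c₀ c with huc
  set wa := dω c₀ a with hwa
  set Hc := Matrix.of (Hf (U c₀)) with hHc_def
  set Jc := Matrix.of (Jf (U c₀)) with hJc_def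
  set q := Matrix.of (dJf (U c₀) uc) *ᵥ ub with hq_def
  have A1 : ua ⬝ᵥ (Hc *ᵥ d2U c b) = wa ⬝ᵥ q := by
    have h1 : ua ⬝ᵥ (Hc *ᵥ d2U c b) = (Hc *ᵥ ua) ⬝ᵥ d2U c b := by
      rw [← transpose_mulVec_dotProduct, hsym]
    have h2 : Hc *ᵥ ua = -(Jcᵀ *ᵥ wa) := eq_neg_of_add_eq_zero_left p1a
    have h3 : Jc *ᵥ d2U c b = -q := eq_neg_of_add_eq_zero_right pE2
    rw [h1, h2, neg_dotProduct, transpose_mulVec_dotProduct, h3, dotProduct_neg, neg_neg]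
  have A2 : ua ⬝ᵥ ((Matrix.of (dJf (U c₀) ub))ᵀ *ᵥ dω c₀ c) = dω c₀ c ⬝ᵥ (Matrix.of (dJf (U c₀) ub) *ᵥ ua) := by
    rw [dotProduct_comm, transpose_mulVec_dotProduct]
  have A3 : ua ⬝ᵥ ((Matrix.of (dJf (U c₀) uc))ᵀ *ᵥ dω c₀ b) = dω c₀ b ⬝ᵥ (Matrix.of (dJf (U c₀) uc) *ᵥ ua) := by
    rw [dotProduct_comm, transpose_mulVec_dotProduct]
  have A4 : ua ⬝ᵥ (Jcᵀ *ᵥ d2ω c b) = d2ω c b ⬝ᵥ a := by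
    rw [dotProduct_comm, transpose_mulVec_dotProduct, p2a]
  have main := congrArg (fun z : κ → ℝ => ua ⬝ᵥ z) hS2
  simp only [dotProduct_add, dotProduct_zero] at main
  rw [A1, A2, A3, A4] at main
  linarith

/-- [folklore] **THE ROW'S DISPLAY WITH ALL THREE ARGUMENTS FREE**: along the line `c₀ + s•c`, the Hessian entry `s ↦ D²V(c₀ + s•c)[b][a]` of the
tree-level effective action `V := A ∘ U` has derivative at `s = 0`
`(Ha) ⬝ ∂H[Hc]Hb − (Δa) ⬝ ∂J[Hc]Hb − (Δb) ⬝ ∂J[Hc]Ha − (Δc) ⬝ ∂J[Hb]Ha` with `H := minOp H_c J_c`, `Δ := effForm H_c J_c` — for symmetric `A‴`, `∂²Q`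
this is `∂³S_W[Ha,Hb,Hc] − 3·Sym⟨Δa, ∂²Q[Hb,Hc]⟩` (H2V4-STATEMENT §2). -/
theorem hasDerivAt_thirdJet_value_polar {A : (κ → ℝ) → ℝ} {f : (κ → ℝ) → (κ → ℝ)} {Hf : (κ → ℝ) → κ → κ → ℝ}
    {dH : (κ → ℝ) →L[ℝ] (κ → κ → ℝ)} {Q : (κ → ℝ) → (μ → ℝ)} {Jf : (κ → ℝ) → μ → κ → ℝ} {dJf : (κ → ℝ) → ((κ → ℝ) →L[ℝ] (μ → κ → ℝ))}
    {d2Jf : (κ → ℝ) →L[ℝ] (κ → ℝ) →L[ℝ] (μ → κ → ℝ)}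
    {U : (μ → ℝ) → (κ → ℝ)} {dU : (μ → ℝ) → ((μ → ℝ) →L[ℝ] (κ → ℝ))} {d2U : (μ → ℝ) →L[ℝ] (μ → ℝ) →L[ℝ] (κ → ℝ)}
    {ω : (μ → ℝ) → (μ → ℝ)} {dω : (μ → ℝ) → ((μ → ℝ) →L[ℝ] (μ → ℝ))} {d2ω : (μ → ℝ) →L[ℝ] (μ → ℝ) →L[ℝ] (μ → ℝ)} {c₀ : μ → ℝ}
    (hA : ∀ᶠ c in 𝓝 c₀, HasFDerivAt A (dotCLM (f (U c))) (U c))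
    (hf : ∀ᶠ x in 𝓝 (U c₀), HasFDerivAt f (mulVecCLM (Matrix.of (Hf x))) x) (hH : HasFDerivAt Hf dH (U c₀))
    (hsym : (Matrix.of (Hf (U c₀)))ᵀ = Matrix.of (Hf (U c₀)))
    (hQ : ∀ᶠ x in 𝓝 (U c₀), HasFDerivAt Q (mulVecCLM (Matrix.of (Jf x))) x) (hJ : ∀ᶠ x in 𝓝 (U c₀), HasFDerivAt Jf (dJf x) x)
    (hdJ : HasFDerivAt dJf d2Jf (U c₀))
    (hU : ∀ᶠ c in 𝓝 c₀, HasFDerivAt U (dU c) c) (hdU : HasFDerivAt dU d2U c₀)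
    (hω : ∀ᶠ c in 𝓝 c₀, HasFDerivAt ω (dω c) c) (hdω : HasFDerivAt dω d2ω c₀)
    (hid : ∀ᶠ c in 𝓝 c₀, f (U c) + (Matrix.of (Jf (U c)))ᵀ *ᵥ ω c = 0 ∧ Q (U c) = c) (hω0 : ω c₀ = 0)
    (hkkt : IsUnit (kkt (Matrix.of (Hf (U c₀))) (Matrix.of (Jf (U c₀)))).det) (a b c : μ → ℝ) :
    HasDerivAt (fun s : ℝ => fderiv ℝ (fderiv ℝ (A ∘ U)) (c₀ + s • c) b a)
      ((minOp (Matrix.of (Hf (U c₀))) (Matrix.of (Jf (U c₀))) *ᵥ a)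
          ⬝ᵥ (Matrix.of (dH (minOp (Matrix.of (Hf (U c₀))) (Matrix.of (Jf (U c₀))) *ᵥ c))
            *ᵥ (minOp (Matrix.of (Hf (U c₀))) (Matrix.of (Jf (U c₀))) *ᵥ b))
        - (effForm (Matrix.of (Hf (U c₀))) (Matrix.of (Jf (U c₀))) *ᵥ a)
          ⬝ᵥ (Matrix.of (dJf (U c₀) (minOp (Matrix.of (Hf (U c₀))) (Matrix.of (Jf (U c₀))) *ᵥ c))
            *ᵥ (minOp (Matrix.of (Hf (U c₀))) (Matrix.of (Jf (U c₀))) *ᵥ b))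
        - (effForm (Matrix.of (Hf (U c₀))) (Matrix.of (Jf (U c₀))) *ᵥ b)
          ⬝ᵥ (Matrix.of (dJf (U c₀) (minOp (Matrix.of (Hf (U c₀))) (Matrix.of (Jf (U c₀))) *ᵥ c))
            *ᵥ (minOp (Matrix.of (Hf (U c₀))) (Matrix.of (Jf (U c₀))) *ᵥ a))
        - (effForm (Matrix.of (Hf (U c₀))) (Matrix.of (Jf (U c₀))) *ᵥ c)
          ⬝ᵥ (Matrix.of (dJf (U c₀) (minOp (Matrix.of (Hf (U c₀))) (Matrix.of (Jf (U c₀))) *ᵥ b))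
            *ᵥ (minOp (Matrix.of (Hf (U c₀))) (Matrix.of (Jf (U c₀))) *ᵥ a))) 0 := by
  -- near `c₀`: `D²V(c')[b][a] = −(dω c' b) ⬝ a`; pull back along the line
  have h2 := fderiv_fderiv_value hA hQ hU hω hid
  have hline : ∀ s : ℝ, HasDerivAt (fun s : ℝ => c₀ + s • c) c s := fun s => by
    have h := ((hasDerivAt_id s).smul_const c).const_add c₀
    rwa [one_smul] at h
  have hcont : Tendsto (fun s : ℝ => c₀ + s • c) (𝓝 0) (𝓝 c₀) := by
    have h := (hline 0).continuousAt.tendsto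
    rwa [zero_smul, add_zero] at h
  have heq : (fun s : ℝ => fderiv ℝ (fderiv ℝ (A ∘ U)) (c₀ + s • c) b a) =ᶠ[𝓝 0] fun s : ℝ => -(dω (c₀ + s • c) b ⬝ᵥ a) := by
    filter_upwards [hcont.eventually h2] with s hs
    exact hs.2 b a
  have hwb : HasDerivAt (fun s : ℝ => dω (c₀ + s • c) b) (d2ω c b) 0 := hasDerivAt_dU_line₂ hdω c b
  have hd : HasDerivAt (fun s : ℝ => -(dω (c₀ + s • c) b ⬝ᵥ a)) (-(d2ω c b ⬝ᵥ a)) 0 := by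
    have h := (hasDerivAt_dotProduct hwb (hasDerivAt_const (0 : ℝ) a)).neg
    refine h.congr_deriv ?_
    rw [dotProduct_zero, add_zero]
  refine (hd.congr_of_eventuallyEq heq).congr_deriv ?_
  rw [d2ω_dotProduct_polar hf hH hsym hQ hJ hdJ hU hdU hω hdω hid hω0 a b c]
  obtain ⟨hUa, hωa⟩ := dU_dω_eq_of_identities hf hQ hJ hU hω hid hω0 hkkt a
  obtain ⟨hUb, hωb⟩ := dU_dω_eq_of_identities hf hQ hJ hU hω hid hω0 hkkt b
  obtain ⟨hUc, hωc⟩ := dU_dω_eq_of_identities hf hQ hJ hU hω hid hω0 hkkt c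
  rw [hUa, hUb, hUc, hωa, hωb, hωc]
  simp only [neg_dotProduct]
  ring

end Polar

end Summit.QuantumFields.BalabanUV.Beta.FP.ValueFunctionThirdJetPolar

end
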